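import Mathlib
import HarnessLib
import Summits.Ventures.LatticeQCDFlow.Scaling.AcceptanceEssEightNinthsStrict
import Summits.Ventures.LatticeQCDFlow.Scaling.AcceptanceMidpointLaw

/-!
# LatticeQCDFlow / Scaling — the untrained Wilson sampler under the midpoint law: the second floor
# `Z(β/2)²/Z(β) · e^{−|β|·N·#plaquettes/√2} ≤ acc`, every compact `G`, every `β`

HONEST FRAMING: exact (Metropolis-corrected) sampling algorithms for lattice gauge theory;
figures of merit are autocorrelation/cost numbers at stated couplings and volumes; no
continuum-physics claim.

Venture `LatticeQCDFlow` (cell pub-lqcd), topic `Scaling`; FANOUT row 3 (`s0-u1-a`, S0-B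
implementation A, GEN-15).  NEW WORK of the cell (a corollary, no numerics); NO definition is
introduced.  SETTING of row 3's `Scaling/WilsonIdentityFlowLaw` / `…AcceptanceEssEightNinthsStrict`
(GEN-13/14, imported): a compact gauge group `G`, a continuous representation
`ρ : G →* M_N(ℂ)`, the Wilson action `S = Σ_plaquettes (N − Re tr ρ(holonomy))` on the periodic
lattice `(ℤ/L)^d`, a reference PROBABILITY law `μ` on configurations (`μ = Haar^{⊗E}` is the
untrained flow of the cell), the target density `p = e^{−βS}/Z_μ(β)` against the model `q = 1`,
`Z_μ(β) = ∫ e^{−βS} dμ`, and the equilibrium acceptance `acc = ∫∫ min(p(U), p(U′)) dμ dμ` of the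
exact sampler proposing from `μ`.  There: `(8/9)·Z(β)²/Z(2β) < acc < Z(β/2)²/Z(β)` (the ESS floor
and the Bhattacharyya ceiling, strict).  Row 3's `Scaling/AcceptanceMidpointLaw` (GEN-15,
imported) gives a second floor from the spread of the log weight under the midpoint law
`ρ_mid ∝ e^{−βS/2}μ`: the log weight `−βS − log Z` lies within `|β|·N·#plaquettes` of a constant
(`0 ≤ S ≤ 2N·#plaquettes`), hence

* `abs_wilson_logWeight_sub_le` — `|log(p(U)/1) − c₀| ≤ |β|·N·#plaquettes` for
  `c₀ = −log Z_μ(β) − β·N·#plaquettes`;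
* **`wilsonIdentityFlow_meanAccept_ge_bhatt_exp`** — for every compact `G`, continuous `ρ`, `d`,
  `L`, reference probability law `μ` and EVERY real `β`:
  `Z_μ(β/2)²/Z_μ(β) · exp(−|β|·N·#plaquettes/√2) ≤ acc`;
  **`wilsonIdentityFlow_meanAccept_ge_bhatt_exp_partitionFunction`** — the same with
  `μ = Haar^{⊗E}` and `Z = (partitionFunction ρ ·).toReal`.

Reading (value-free): the Bhattacharyya ceiling `Z(β/2)²/Z(β)` of the untrained sampler's
acceptance is attained up to the factor `e^{−|β|N·#plaquettes/√2}` — a bound that is sharp in its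
dependence on the spread of the action only at small `|β|·N·#plaquettes` (the whole lattice is ONE
block here; for independent blocks the correction is `e^{−O(√#blocks)}`,
`Scaling/AcceptanceVolumeRatePi`).  Which of the two floors (`(8/9)·ESS` or this one) is larger
depends on `(β, N, L, d)`; nothing is claimed about that comparison.  NOT CLAIMED: any value of
ours; nothing re-scored, SEALED.md untouched.
-/

namespace Summit.Ventures.LatticeQCDFlow.Theory2

open MeasureTheory Real
open Literature.MathematicalPhysics.QuantumFieldTheory

section Wilson

variable {d L N : ℕ} [NeZero L] {G : Type*} [Group G] [TopologicalSpace G] [IsTopologicalGroup G]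
  [CompactSpace G] [MeasurableSpace G] [BorelSpace G] (ρ : G →* Matrix (Fin N) (Fin N) ℂ)
  (μ : Measure (GaugeConfig d L G)) [IsProbabilityMeasure μ]

omit [MeasurableSpace G] [BorelSpace G] in
/-- **The Wilson log weight lies within `|β|·N·#plaquettes` of a constant**: for `Z > 0` and
`c₀ = −log Z − β·N·#plaquettes`, `|log((e^{−βS(U)}/Z)/1) − c₀| ≤ |β|·N·#plaquettes`
(`0 ≤ S ≤ 2N·#plaquettes`). [ours] -/
theorem abs_wilson_logWeight_sub_le (hρ : Continuous ρ) (β : ℝ) {Z : ℝ} (hZ : 0 < Z)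
    (U : GaugeConfig d L G) :
    |Real.log (Real.exp (-β * wilsonAction ρ U) / Z / 1)
        - (-Real.log Z - β * (N * Fintype.card (Plaquette d L)))|
      ≤ |β| * (N * Fintype.card (Plaquette d L)) := by
  have hS0 : 0 ≤ wilsonAction ρ U := wilsonAction_nonneg_of_re_trace_le ρ (fun h => by
    have hb := Literature.RepresentationTheory.CompactGroups.CompactGroup.abs_re_trace_le_card ρ hρ h
    rw [Fintype.card_fin] at hb
    exact (abs_le.1 hb).2) U
  have hS1 := wilsonAction_le_card ρ hρ U
  rw [div_one, Real.log_div (Real.exp_pos _).ne' hZ.ne', Real.log_exp,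
    show -β * wilsonAction ρ U - Real.log Z - (-Real.log Z - β * (N * Fintype.card (Plaquette d L)))
      = β * (N * Fintype.card (Plaquette d L) - wilsonAction ρ U) by ring, abs_mul]
  refine mul_le_mul_of_nonneg_left (abs_le.2 ⟨?_, ?_⟩) (abs_nonneg β) <;> linarith

/-- **THE MIDPOINT-LAW FLOOR FOR THE UNTRAINED WILSON SAMPLER**: for every compact `G`, continuous
`ρ`, `d`, `L`, reference probability law `μ` and every real `β`,
`Z_μ(β/2)²/Z_μ(β) · exp(−|β|·N·#plaquettes/√2) ≤ ∫∫ min(p(U), p(U′)) dμ dμ`, `p = e^{−βS}/Z_μ(β)`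
— the Bhattacharyya ceiling is missed by at most the stated factor. [ours] -/
theorem wilsonIdentityFlow_meanAccept_ge_bhatt_exp (hρ : Continuous ρ) (β : ℝ) :
    (∫ U, Real.exp (-(β / 2) * wilsonAction ρ U) ∂μ) ^ 2 / (∫ V, Real.exp (-β * wilsonAction ρ V) ∂μ)
        * Real.exp (-(|β| * (N * Fintype.card (Plaquette d L)) / Real.sqrt 2))
      ≤ ∫ U, ∫ U', min (Real.exp (-β * wilsonAction ρ U) / ∫ V, Real.exp (-β * wilsonAction ρ V) ∂μ)
          (Real.exp (-β * wilsonAction ρ U') / ∫ V, Real.exp (-β * wilsonAction ρ V) ∂μ) ∂μ ∂μ := by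
  set Z : ℝ := ∫ V, Real.exp (-β * wilsonAction ρ V) ∂μ with hZdef
  have hZ : 0 < Z := wilsonZI_pos ρ μ hρ β
  have hp0 : ∀ U : GaugeConfig d L G, 0 ≤ Real.exp (-β * wilsonAction ρ U) / Z :=
    fun U => (div_pos (Real.exp_pos _) hZ).le
  have hq0 : ∀ _U : GaugeConfig d L G, (0 : ℝ) ≤ 1 := fun _ => zero_le_one
  have hqm : Measurable fun _ : GaugeConfig d L G => (1 : ℝ) := measurable_const
  have hqi : Integrable (fun _ : GaugeConfig d L G => (1 : ℝ)) μ := integrable_const _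
  have hB : 0 < ∫ U, Real.sqrt (Real.exp (-β * wilsonAction ρ U) / Z * 1) ∂μ := by
    simp_rw [mul_one]
    rw [integral_sqrt_wilsonD ρ μ hρ]
    exact div_pos (wilsonZI_pos ρ μ hρ _) (Real.sqrt_pos.2 hZ)
  have h := sq_integral_sqrt_mul_exp_le_meanAccept_of_abs_le (μ := μ) hp0
    (measurable_wilsonD ρ hρ β Z) (integrable_wilsonD ρ μ hρ β Z) hq0 hqm hqi hB
    (c := -Real.log Z - β * (N * Fintype.card (Plaquette d L))) (by positivity)
    (fun U _ _ => abs_wilson_logWeight_sub_le ρ hρ β hZ U)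
  simp_rw [mul_one] at h
  rw [integral_sqrt_wilsonD ρ μ hρ, div_pow, Real.sq_sqrt hZ.le] at h
  exact h

/-- **`Z(β/2)²/Z(β) · e^{−|β|N·#plaquettes/√2} ≤ acc`** for the untrained flow of the cell
(`μ = Haar^{⊗E}`, `Z = (partitionFunction ρ ·).toReal`), every `β`. [ours] -/
theorem wilsonIdentityFlow_meanAccept_ge_bhatt_exp_partitionFunction (hρ : Continuous ρ) (β : ℝ) :
    (partitionFunction (d := d) (L := L) ρ (β / 2)).toReal ^ 2
        / (partitionFunction (d := d) (L := L) ρ β).toReal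
        * Real.exp (-(|β| * (N * Fintype.card (Plaquette d L)) / Real.sqrt 2))
      ≤ ∫ U, ∫ U', min (Real.exp (-β * wilsonAction ρ U) / ∫ V, Real.exp (-β * wilsonAction ρ V)
            ∂(Measure.pi fun _ : Edge d L => haarProbability G))
          (Real.exp (-β * wilsonAction ρ U') / ∫ V, Real.exp (-β * wilsonAction ρ V)
            ∂(Measure.pi fun _ : Edge d L => haarProbability G))
          ∂(Measure.pi fun _ : Edge d L => haarProbability G)
          ∂(Measure.pi fun _ : Edge d L => haarProbability G) := by
  rw [partitionFunction_toReal_eq_integral ρ hρ, partitionFunction_toReal_eq_integral ρ hρ]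
  exact wilsonIdentityFlow_meanAccept_ge_bhatt_exp ρ _ hρ β

end Wilson

end Summit.Ventures.LatticeQCDFlow.Theory2
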